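import Summits.QuantumFields.BalabanUV.Beta.D1BFx.KLimitGluon
import Summits.QuantumFields.BalabanUV.Beta.D1BFx.TorusCombKKT

/-!
# `BalabanUV.Beta.D1BFx.KLimitAxial` — road «BF-x» for binder row D1, slot (K), `K-ASSEMBLY-SPEC-v2.md` §4 brick **TB5-2b: THE M-SIDE (AXIAL-GAUGE
# LITERAL) LIMIT OF ROUTE T** — the `p → ∞` limit of the FIRST term of TB5-1 `KTransferTorus.hessT_transfer_road`:
# (i) for ANY matrix `S`, `hessT (S·L; V, V′, W) = hessT (L; V·S, V′·S, W·S)` (cyclicity — the multiplier SIGN moves from the leg to the jets);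
# (ii) by TB1 `TorusCombKKT.inv_MT_packed_eq`, on every coarse torus `hessT (M_T⁻¹|_{ν⊕μ}; V, V′, W) = hessT (blocksHat p (sortK n G); V·S_g, V′·S_g, W·S_g)`,
# `G := coDressKBmAt (toSite r) n (KInvStep n 0)` (the literal's Π_bm-dressed one-step resolvent), `S_g = fromBlocks 1 0 0 (−1)` (so `V·S_g` = the
# jet in the literal's `[[δd, −𝒬ᵀ],[𝒬, 0]]` convention); (iii) the TB5 socket for the leg `G` (its four sockets BY NAME: `decays_coDressKBmAt_KInvStep`,
# `shiftK_coDressKBmAt_KInvStep`, `coDressKBmAt_KInvStep_inr_row_off∕_col_off`): `hessT (blocksHat (p k) (sortK n G); arrays) ⟶ hessKer G 𝒱 𝒲 μ ν z`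

HONEST FRAMING (cell contract, verbatim): «discharging `BetaPertH` makes Bałaban's UV stability UNCONDITIONAL — a real constructive-QFT
result; it is NOT the continuum limit and NOT the Clay problem.»  HONEST DEPENDENCY (verbatim): «continuum YM on T⁴ ⇐ BetaPertH ∧ nine
spine estimates (0/9 proved); BetaPertH ⇐ (D1) ∧ (D4) ∧ CAP+tail; G-an2-4 gates asym, D1 and NE2/3/4.»  THIS MODULE DISCHARGES NOTHING of
D1 / BetaPertH: [folklore] trace cyclicity + compositions BY NAME (leaf-03-g8 `TorusCombKKT.inv_MT_packed_eq`, this lineage's `KLimitGluon`,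
the β cell's `AxialDressingRooted` sockets).  No `def`, no `def … : Prop`, nothing cited, 0 sorry.  DISPLAYED: the in-block root `r ∈ box (d+1) n`
and the bilocalisation of the table families (TB4's sockets).  NOT summit progress; NOT BetaPertH, NOT continuum, NOT Clay.

ABSOLUTE RULE (cell, verbatim): «No internally-minted statement may enter as a cited fact. Every hypothesis is either kernel-proved in this
package or a verbatim quotation of a PUBLISHED theorem with page reference. The manuscript(s) under audit are NOT citable for their own
disputed steps — they are the thing under adjudication; programme-internal (2001/route/tribunal) claims are never citable.»

CONTENT (all [folklore]).
* §1 `trace_mul_cycle₄`, **`hessT_mul_leg`**: `hessT (S * L) V V' W = hessT L (V * S) (V' * S) (W * S)`.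
* §2 **`hessT_inv_MT_corner`** (per torus, TB1): the M-side functional over the sign-flipped jets and the periodised dressed one-step resolvent.
* §3 **`tendsto_hessT_coDressKInvStep`**: the TB5 socket for the literal's leg `G`.
Unit `b2b-balaban-beta-d1-p2` (road owner, gen 6).
-/

noncomputable section

namespace Summit.QuantumFields.BalabanUV.Beta.D1BFx.KLimitAxial

open Matrix Filter Topology
open scoped BigOperators
open Literature.Probability.LatticeModels (TorusSite Torus.proj)
open Literature.MathematicalPhysics.QuantumFieldTheory.Balaban1983to89
open Literature.MathematicalPhysics.QuantumFieldTheory.Balaban1983to89.Beta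
open Literature.MathematicalPhysics.QuantumFieldTheory.Balaban1983to89.Beta.Composition (kkt)
open ExpKernelCalculus (MKer Decays BiLoc hessKer shiftK)
open AffineAveraging (box toSite)
open OneStepResolventKernel (Fib)
open OneStepKernelFamily (KInvStep)
open Summit.QuantumFields.BalabanUV.Beta.AxialDressingRooted (coDressKBmAt decays_coDressKBmAt_KInvStep shiftK_coDressKBmAt_KInvStep
  coDressKBmAt_KInvStep_inr_row_off coDressKBmAt_KInvStep_inr_col_off)
open Summit.QuantumFields.BalabanUV.Beta.D1BFx.SortedKernels (blocksHat)
open Summit.QuantumFields.BalabanUV.Beta.D1BFx.SortedPack (sortK blockCov_of_neg)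
open Summit.QuantumFields.BalabanUV.Beta.D1BFx.PeriodicArrays (arr)
open Summit.QuantumFields.BalabanUV.Beta.D1BFx.MixedVarPackedHess (hessT)
open Summit.QuantumFields.BalabanUV.Beta.D1BFx.TorusCombKKT (I J CombRows tauT Khat Qhat inv_MT_packed_eq)
open Summit.QuantumFields.BalabanUV.Beta.D1BFx.KLimitGluon (tendsto_hessT_blocksHat_sortK)

/-! ## §1 The multiplier sign moves from the leg to the jets -/

section Cyclic

variable {ι : Type*} [Fintype ι]

/-- [folklore] `tr (S L V S L V′) = tr (L (V S) L (V′ S))` (cyclicity). -/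
theorem trace_mul_cycle₄ (S L V V' : Matrix ι ι ℝ) : (S * L * V * (S * L * V')).trace = (L * (V * S) * (L * (V' * S))).trace := by
  rw [show S * L * V * (S * L * V') = S * (L * (V * S) * (L * V')) by simp only [Matrix.mul_assoc], Matrix.trace_mul_comm]
  simp only [Matrix.mul_assoc]

/-- [folklore] **THE SIGN MOVES**: `hessT (S * L) V V' W = hessT L (V * S) (V' * S) (W * S)` for ANY square `S` (no hypothesis on `S`). -/
theorem hessT_mul_leg (S L V V' W : Matrix ι ι ℝ) : hessT (S * L) V V' W = hessT L (V * S) (V' * S) (W * S) := by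
  unfold hessT
  rw [trace_mul_cycle₄, show S * L * W = S * (L * W) by rw [Matrix.mul_assoc], Matrix.trace_mul_comm, Matrix.mul_assoc]

end Cyclic

/-! ## §2 Per torus: the M-side functional over the periodised dressed one-step resolvent -/

section Torus

variable {d n : ℕ} [NeZero n] {r : Fin (d + 1) → ℕ} (hr : r ∈ box (d + 1) n) (p : ℕ) [NeZero p]
include hr

/-- [folklore] **TB5-2b, PER TORUS** (TB1 `inv_MT_packed_eq` ∘ §1): for ANY jets `V V′ W` on `ν ⊕ μ`,
`hessT ((kkt K̂ [Q̂; τ_T])⁻¹|_{ν⊕μ}) V V′ W = hessT (blocksHat p (sortK n G)) (V·S_g) (V′·S_g) (W·S_g)`, `G = coDressKBmAt (toSite r) n (KInvStep n 0)`,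
`S_g = fromBlocks 1 0 0 (−1)`. -/
theorem hessT_inv_MT_corner (V V' W : Matrix (I d n p ⊕ J d p) (I d n p ⊕ J d p) ℝ) :
    hessT ((kkt (Khat (d := d) n p) (Matrix.fromRows (Qhat (d := d) n p) (tauT (toSite r) n p)))⁻¹.submatrix
        (Sum.map id Sum.inl) (Sum.map id Sum.inl)) V V' W
      = hessT (blocksHat p (sortK n (coDressKBmAt (toSite r) n (KInvStep (d := d) n 0))))
          (V * Matrix.fromBlocks (1 : Matrix (I d n p) (I d n p) ℝ) 0 0 (-1 : Matrix (J d p) (J d p) ℝ))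
          (V' * Matrix.fromBlocks (1 : Matrix (I d n p) (I d n p) ℝ) 0 0 (-1 : Matrix (J d p) (J d p) ℝ))
          (W * Matrix.fromBlocks (1 : Matrix (I d n p) (I d n p) ℝ) 0 0 (-1 : Matrix (J d p) (J d p) ℝ)) := by
  rw [inv_MT_packed_eq hr p, hessT_mul_leg]

end Torus

/-! ## §3 The TB5 socket for the literal's leg -/

/-- [folklore] **TB5-2b, THE LIMIT**: for the literal's Π_bm-dressed one-step resolvent `G = coDressKBmAt (toSite r) n (KInvStep n 0)` (decaying, block
covariant, lattice supported — the β cell's sockets BY NAME) and ANY bilocalised table families `𝒱`, `𝒲`: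
`hessT (blocksHat (p k) (sortK n G); blocksHat (p k) (sortK n (arr (n·p k) ·))) ⟶ hessKer G 𝒱 𝒲 μ ν z` as `p k → ∞`. -/
theorem tendsto_hessT_coDressKInvStep {d n : ℕ} [NeZero n] {r : Fin (d + 1) → ℕ} (hr : r ∈ box (d + 1) n)
    (𝒱 : Fin (d + 1) → (Fin (d + 1) → ℤ) → MKer (d + 1) (Fib d))
    (𝒲 : Fin (d + 1) → (Fin (d + 1) → ℤ) → Fin (d + 1) → (Fin (d + 1) → ℤ) → MKer (d + 1) (Fib d))
    (μ ν : Fin (d + 1)) (z : Fin (d + 1) → ℤ) {P P' Q Q' : Fin (d + 1) → ℤ} {Cv Cv' C δ : ℝ}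
    (hV : BiLoc (𝒱 μ 0) P P' Cv δ) (hV' : BiLoc (𝒱 ν z) Q' Q Cv' δ) (hW : BiLoc (𝒲 μ 0 ν z) P Q C δ) (hδ : 0 < δ)
    {p : ℕ → ℕ} [∀ k, NeZero (p k)] (hp : Tendsto p atTop atTop) :
    Tendsto (fun k => hessT (blocksHat (p k) (sortK n (coDressKBmAt (toSite r) n (KInvStep (d := d) n 0))))
        (blocksHat (p k) (sortK n (arr (n * p k) (𝒱 μ 0))))
        (blocksHat (p k) (sortK n (arr (n * p k) (𝒱 ν z))))
        (blocksHat (p k) (sortK n (arr (n * p k) (𝒲 μ 0 ν z)))))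
      atTop (𝓝 (hessKer (coDressKBmAt (toSite r) n (KInvStep (d := d) n 0)) 𝒱 𝒲 μ ν z)) := by
  obtain ⟨δA, CA, hδA, -, hdec⟩ := decays_coDressKBmAt_KInvStep (d := d) hr 0
  exact tendsto_hessT_blocksHat_sortK hdec hδA (blockCov_of_neg fun t => shiftK_coDressKBmAt_KInvStep (toSite r) 0 t)
    (fun x y f b hx => coDressKBmAt_KInvStep_inr_row_off (toSite r) 0 hx y f b)
    (fun x y a₀ f hy => coDressKBmAt_KInvStep_inr_col_off (toSite r) 0 hy x a₀ f)
    𝒱 𝒲 μ ν z hV hV' hW hδ hp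

end Summit.QuantumFields.BalabanUV.Beta.D1BFx.KLimitAxial

end
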